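import Summits.CriticalPhenomena.PercolationContinuityZ3.Theorems.PercNearOneGluingNoHeavyLowerTailAntitheticZones
import Summits.CriticalPhenomena.PercolationContinuityZ3.Theorems.PercNearOneGluingNoHeavyLowerTailAntitheticLatticePieces
import HarnessLib

/-!
# `NoHeavyLowerTail` (stmt-CriticalPhenomena-4575) — antithetic cluster pairs: BIC({c}) for a vertex at distance two whose neighbourhood is a
# CLIQUE OF NEIGHBOURS OF `s` — part 1: zones (THEOREM J, prim-hp-2 gen 36; MEMO-gen36 §4f)

Support file (`--supports stmt-CriticalPhenomena-4575`, hull-port prover `prim-hp-2`, gen 36).  No named facts, no sorries; standard axioms.  The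
`def`s `Antithetic.Apex.{zoneJ, blkJ, partJ}` are proof-internal bookkeeping; the theorem `Antithetic.bic_cliqueApex_nonneg` is stated without them.

THEOREM J.  `E` an edge set on a finite vertex type, `s` the source, `c ≠ s` NOT adjacent to `s`, every `E`-neighbour of `c` adjacent to `s`, and
the `E`-neighbours of `c` pairwise adjacent.  Then `BIC_E({c}) ≥ 0`: conditioned on `c` not lying in both the red and the blue cluster of `s`,
the two clusters are concordant on average.  This is the structure ("apex of a `K₄ − e` seen from a degree-two vertex") carried by every
smallest instance left open by Theorems D, F, H, I (coverage census of MEMO-gen36 §4e); the rule was found by the census script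
HOME/code/gen36/lab36/zonerule.py (0 failures on all 399 instances with n ≤ 5) and is proved here for all graphs.

RULE.  zone(c) = the cluster of `c` in the colour in which `c` is NOT reached, if `c` is reached; `{c}` if `c` is reached in neither colour.  KEY
FACT (`Apex.mono_of_unreached`): if `c` is reached in neither colour then all `E`-edges at `c` have the same colour (two differently coloured
edges `cu, cv` would force `u` blue-reached-only and `v` red-reached-only, and then the clique edge `uv` cannot be coloured).  With it: the
zone's boundary is monochromatic, members of the part stay in the constraint set (sealing), and the zone is the same for every member (the
four cases reached/unreached × block up/down, `Apex.zoneJ_eq_of_mem`).  Harris on the two-atom block algebra and the partition principle finish.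
[cite: VandenbergHaggstromKahn2005, §1 p. 6 ("Harris' inequality"), §1 p. 3 (open cluster `C_s`)]
-/

noncomputable section

namespace Summit.CriticalPhenomena.PercolationContinuityZ3.Theorems

open Literature.Probability.Percolation
open scoped Classical symmDiff

namespace Antithetic

namespace Apex

variable {V : Type*}

/-- The ZONE of `c`: `c` together with its blue cluster if `c` is red-reached and its red cluster if `c` is blue-reached. [this work] -/
def zoneJ (E : Set (Sym2 V)) (s c : V) (T : Set (Sym2 V)) : Set V :=
  {v | v = c ∨ ((openGraph (T ∩ E)).Reachable s c ∧ (openGraph (Tᶜ ∩ E)).Reachable c v) ∨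
    ((openGraph (Tᶜ ∩ E)).Reachable s c ∧ (openGraph (T ∩ E)).Reachable c v)}

/-- The zone block: edges of `E` meeting the zone. [this work] -/
def blkJ (E : Set (Sym2 V)) (s c : V) (T : Set (Sym2 V)) : Set (Sym2 V) := {e | e ∈ E ∧ ∃ v ∈ zoneJ E s c T, v ∈ e}

/-- The part of `T`: colourings agreeing with `T` or with `Tᶜ` on the whole zone block (free elsewhere). [this work] -/
def partJ [Fintype V] (E : Set (Sym2 V)) (s c : V) (T : Set (Sym2 V)) : Finset (Set (Sym2 V)) :=
  Finset.univ.filter fun M => (∀ e ∈ blkJ E s c T, e ∈ M ↔ e ∈ T) ∨ (∀ e ∈ blkJ E s c T, e ∈ M ↔ e ∉ T)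

section Lemmas

variable {E : Set (Sym2 V)} {s c : V} {T : Set (Sym2 V)}

/-- `c` lies in its zone. [this work] -/
theorem mem_zoneJ_self : c ∈ zoneJ E s c T := Or.inl rfl

/-- A vertex reached from `s` in a configuration `η` and different from `s` has an `η`-open pair at it leading to a reached vertex. [folklore] -/
theorem exists_adj_of_reachable {η : Set (Sym2 V)} {x : V} (hxs : x ≠ s) (h : (openGraph η).Reachable s x) :
    ∃ u, s(x, u) ∈ η ∧ u ≠ x := by
  obtain ⟨p⟩ := h
  cases hp : p.reverse with
  | nil => exact absurd rfl hxs
  | cons hadj _ =>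
    rw [openGraph_adj] at hadj
    exact ⟨_, hadj.1, hadj.2.symm⟩

/-- If no pair of `η` contains `x` then the `η`-cluster of `x` is `{x}` (as a reachability statement). [folklore] -/
theorem eq_of_reachable_of_isolated {η : Set (Sym2 V)} {x y : V} (hx : ∀ u, s(x, u) ∈ η → u = x)
    (h : (openGraph η).Reachable x y) : y = x := by
  obtain ⟨p⟩ := h
  cases p with
  | nil => rfl
  | cons hadj _ =>
    rw [openGraph_adj] at hadj
    exact absurd (hx _ hadj.1) hadj.2.symm

/-- **KEY FACT.**  Under the hypotheses of Theorem J, if `c` is reached in neither colour then all `E`-edges at `c` have the same colour.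
[this work] -/
theorem mono_of_unreached (hcs : c ≠ s) (hN : ∀ u, s(c, u) ∈ E → u ≠ c → s(s, u) ∈ E)
    (hK : ∀ u v, s(c, u) ∈ E → s(c, v) ∈ E → u ≠ c → v ≠ c → u ≠ v → s(u, v) ∈ E)
    (hr : ¬ (openGraph (T ∩ E)).Reachable s c) (hb : ¬ (openGraph (Tᶜ ∩ E)).Reachable s c) :
    (∀ u, s(c, u) ∈ E → u ≠ c → s(c, u) ∈ T) ∨ (∀ u, s(c, u) ∈ E → u ≠ c → s(c, u) ∉ T) := by
  by_contra hcon
  rw [not_or] at hcon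
  obtain ⟨h1, h2⟩ := hcon
  push Not at h1 h2
  obtain ⟨v, hvE, hvc, hvT⟩ := h1   -- a blue edge cv
  obtain ⟨u, huE, huc, huT⟩ := h2   -- a red edge cu
  -- u is not red-reached (else c would be), hence su is blue and u is blue-reached; v symmetric
  have hus : u ≠ s := fun h => by
    subst h
    exact hr ((openGraph_adj (T ∩ E) u c).2 ⟨⟨by rw [Sym2.eq_swap]; exact huT, by rw [Sym2.eq_swap]; exact huE⟩, hcs.symm⟩).reachable
  have hvs : v ≠ s := fun h => by
    subst h
    exact hb ((openGraph_adj (Tᶜ ∩ E) v c).2 ⟨⟨by rw [Sym2.eq_swap]; exact hvT, by rw [Sym2.eq_swap]; exact hvE⟩, hcs.symm⟩).reachable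
  have hu_notred : ¬ (openGraph (T ∩ E)).Reachable s u := fun h =>
    hr (h.trans ((openGraph_adj (T ∩ E) u c).2 ⟨⟨by rw [Sym2.eq_swap]; exact huT, by rw [Sym2.eq_swap]; exact huE⟩, huc⟩).reachable)
  have hv_notblue : ¬ (openGraph (Tᶜ ∩ E)).Reachable s v := fun h =>
    hb (h.trans ((openGraph_adj (Tᶜ ∩ E) v c).2 ⟨⟨by rw [Sym2.eq_swap]; exact hvT, by rw [Sym2.eq_swap]; exact hvE⟩, hvc⟩).reachable)
  have hsu : s(s, u) ∉ T := fun h => hu_notred ((openGraph_adj (T ∩ E) s u).2 ⟨⟨h, hN u huE huc⟩, hus.symm⟩).reachable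
  have hsv : s(s, v) ∈ T := by
    by_contra h
    exact hv_notblue ((openGraph_adj (Tᶜ ∩ E) s v).2 ⟨⟨h, hN v hvE hvc⟩, hvs.symm⟩).reachable
  have hu_blue : (openGraph (Tᶜ ∩ E)).Reachable s u := ((openGraph_adj (Tᶜ ∩ E) s u).2 ⟨⟨hsu, hN u huE huc⟩, hus.symm⟩).reachable
  have hv_red : (openGraph (T ∩ E)).Reachable s v := ((openGraph_adj (T ∩ E) s v).2 ⟨⟨hsv, hN v hvE hvc⟩, hvs.symm⟩).reachable
  have huv : u ≠ v := fun h => by subst h; exact hvT huT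
  have huvE : s(u, v) ∈ E := hK u v huE hvE huc hvc huv
  by_cases huvT : s(u, v) ∈ T
  · exact hu_notred (hv_red.trans ((openGraph_adj (T ∩ E) v u).2 ⟨⟨by rw [Sym2.eq_swap]; exact huvT, by rw [Sym2.eq_swap]; exact huvE⟩,
      huv.symm⟩).reachable)
  · exact hv_notblue (hu_blue.trans ((openGraph_adj (Tᶜ ∩ E) u v).2 ⟨⟨huvT, huvE⟩, huv⟩).reachable)

/-- The source is not in the zone (for `T` in the constraint set). [this work] -/
theorem s_not_mem_zoneJ (hcs : c ≠ s) (hT : ¬ ((openGraph (T ∩ E)).Reachable s c ∧ (openGraph (Tᶜ ∩ E)).Reachable s c)) :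
    s ∉ zoneJ E s c T := by
  rintro (h | ⟨hr, hb⟩ | ⟨hb, hr⟩)
  · exact hcs h.symm
  · exact hT ⟨hr, hb.symm⟩
  · exact hT ⟨hr.symm, hb⟩

/-- **Boundary of the zone is monochromatic**: for `T` in the constraint set there is a colour (red iff `κ`) carried by every `E`-edge from outside
the zone into it. [this work] -/
theorem boundary_zoneJ (hcs : c ≠ s) (hN : ∀ u, s(c, u) ∈ E → u ≠ c → s(s, u) ∈ E)
    (hK : ∀ u v, s(c, u) ∈ E → s(c, v) ∈ E → u ≠ c → v ≠ c → u ≠ v → s(u, v) ∈ E)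
    (hT : ¬ ((openGraph (T ∩ E)).Reachable s c ∧ (openGraph (Tᶜ ∩ E)).Reachable s c)) :
    ∃ κ : Prop, ∀ x ∉ zoneJ E s c T, ∀ y ∈ zoneJ E s c T, s(x, y) ∈ E → (s(x, y) ∈ T ↔ κ) := by
  by_cases hr : (openGraph (T ∩ E)).Reachable s c
  · -- red-reached: zone = {c} ∪ blue cluster of c = blue cluster of c; boundary red
    have hb : ¬ (openGraph (Tᶜ ∩ E)).Reachable s c := fun h => hT ⟨hr, h⟩
    refine ⟨True, fun x hx y hy hxy => ?_⟩
    simp only [iff_true]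
    have hyc : (openGraph (Tᶜ ∩ E)).Reachable c y := by
      rcases hy with rfl | ⟨-, h⟩ | ⟨h, -⟩
      · exact SimpleGraph.Reachable.refl _
      · exact h
      · exact absurd h hb
    by_contra hT'
    exact hx (Or.inr (Or.inl ⟨hr, hyc.trans ((openGraph_adj (Tᶜ ∩ E) y x).2 ⟨⟨by rw [Sym2.eq_swap]; exact hT',
      by rw [Sym2.eq_swap]; exact hxy⟩, fun h => hx (h ▸ hy)⟩).reachable⟩))
  · by_cases hb : (openGraph (Tᶜ ∩ E)).Reachable s c
    · refine ⟨False, fun x hx y hy hxy => ?_⟩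
      simp only [iff_false]
      have hyc : (openGraph (T ∩ E)).Reachable c y := by
        rcases hy with rfl | ⟨h, -⟩ | ⟨-, h⟩
        · exact SimpleGraph.Reachable.refl _
        · exact absurd h hr
        · exact h
      intro hT'
      exact hx (Or.inr (Or.inr ⟨hb, hyc.trans ((openGraph_adj (T ∩ E) y x).2 ⟨⟨by rw [Sym2.eq_swap]; exact hT',
        by rw [Sym2.eq_swap]; exact hxy⟩, fun h => hx (h ▸ hy)⟩).reachable⟩))
    · -- unreached: zone = {c}, edges at c monochromatic
      have hz : ∀ y ∈ zoneJ E s c T, y = c := by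
        rintro y (rfl | ⟨h, -⟩ | ⟨h, -⟩)
        · rfl
        · exact absurd h hr
        · exact absurd h hb
      rcases mono_of_unreached hcs hN hK hr hb with hm | hm
      · refine ⟨True, fun x hx y hy hxy => ?_⟩
        obtain rfl := hz y hy
        simp only [iff_true]
        rw [Sym2.eq_swap] at hxy ⊢
        exact hm x hxy (fun h => hx (h ▸ hy))
      · refine ⟨False, fun x hx y hy hxy => ?_⟩
        obtain rfl := hz y hy
        simp only [iff_false]
        rw [Sym2.eq_swap] at hxy ⊢
        exact hm x hxy (fun h => hx (h ▸ hy))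

/-- Normal form of the zone when `c` is red-reached (and not blue-reached): the blue cluster of `c`. [this work] -/
theorem zoneJ_eq_of_red (hr : (openGraph (T ∩ E)).Reachable s c) (hb : ¬ (openGraph (Tᶜ ∩ E)).Reachable s c) :
    zoneJ E s c T = openCluster (Tᶜ ∩ E) c := by
  ext v
  constructor
  · rintro (rfl | ⟨-, h⟩ | ⟨h, -⟩)
    · exact mem_openCluster_self _ _
    · exact h
    · exact absurd h hb
  · exact fun h => Or.inr (Or.inl ⟨hr, h⟩)

/-- Normal form of the zone when `c` is reached in neither colour: `{c}`. [this work] -/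
theorem zoneJ_eq_of_none (hr : ¬ (openGraph (T ∩ E)).Reachable s c) (hb : ¬ (openGraph (Tᶜ ∩ E)).Reachable s c) :
    zoneJ E s c T = {c} := by
  ext v
  constructor
  · rintro (rfl | ⟨h, -⟩ | ⟨h, -⟩)
    · rfl
    · exact absurd h hr
    · exact absurd h hb
  · intro h
    exact Or.inl h

/-- The zone is invariant under the global colour swap. [this work] -/
theorem zoneJ_compl : zoneJ E s c Tᶜ = zoneJ E s c T := by
  ext v
  simp only [zoneJ, compl_compl, Set.mem_setOf_eq]
  tauto

/-- The part is invariant under the global colour swap. [this work] -/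
theorem partJ_compl [Fintype V] : partJ E s c Tᶜ = partJ E s c T := by
  ext M
  simp only [partJ, blkJ, zoneJ_compl, Finset.mem_filter, Finset.mem_univ, true_and, Set.mem_compl_iff, not_not]
  tauto

/-- If `c` is red-reached then some edge of `E` at `c` is red. [folklore] -/
theorem exists_red_edge (hcs : c ≠ s) (hr : (openGraph (T ∩ E)).Reachable s c) : ∃ u, s(c, u) ∈ E ∧ u ≠ c ∧ s(c, u) ∈ T := by
  obtain ⟨u, hu, huc⟩ := exists_adj_of_reachable hcs hr
  exact ⟨u, hu.2, huc, hu.1⟩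

/-- If all `E`-edges at `c` are red, the blue cluster of `c` is `{c}`. [folklore] -/
theorem blueCluster_eq_singleton (hm : ∀ u, s(c, u) ∈ E → u ≠ c → s(c, u) ∈ T) : openCluster (Tᶜ ∩ E) c = {c} := by
  ext v
  constructor
  · intro h
    exact eq_of_reachable_of_isolated (fun u hu => by
      by_contra huc
      exact hu.1 (hm u hu.2 huc)) h
  · rintro rfl
    exact mem_openCluster_self _ _

/-- **Members stay in the constraint set.** [this work] -/
theorem mem_constraint_of_mem_partJ [Fintype V] (hcs : c ≠ s) (hN : ∀ u, s(c, u) ∈ E → u ≠ c → s(s, u) ∈ E)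
    (hK : ∀ u v, s(c, u) ∈ E → s(c, v) ∈ E → u ≠ c → v ≠ c → u ≠ v → s(u, v) ∈ E)
    (hT : ¬ ((openGraph (T ∩ E)).Reachable s c ∧ (openGraph (Tᶜ ∩ E)).Reachable s c)) {M : Set (Sym2 V)}
    (hM : M ∈ partJ E s c T) : ¬ ((openGraph (M ∩ E)).Reachable s c ∧ (openGraph (Mᶜ ∩ E)).Reachable s c) := by
  rw [partJ, Finset.mem_filter] at hM
  obtain ⟨κ, hκ⟩ := boundary_zoneJ hcs hN hK hT
  have hsZ := s_not_mem_zoneJ hcs hT (E := E)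
  -- in M every boundary edge of the zone has one colour; then the zone is sealed against the other colour
  have key : ∀ b : Prop, (∀ x ∉ zoneJ E s c T, ∀ y ∈ zoneJ E s c T, s(x, y) ∈ E → (s(x, y) ∈ M ↔ b)) →
      ¬ ((openGraph (M ∩ E)).Reachable s c ∧ (openGraph (Mᶜ ∩ E)).Reachable s c) := by
    intro b hbM ⟨hr, hbl⟩
    by_cases hb0 : b
    · refine not_reachable_of_sealed (Mᶜ ∩ E) s _ hsZ (fun x y hx hy hxy => ?_) mem_zoneJ_self hbl
      exact hxy.1 ((hbM x hx y hy hxy.2).2 hb0)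
    · refine not_reachable_of_sealed (M ∩ E) s _ hsZ (fun x y hx hy hxy => ?_) mem_zoneJ_self hr
      exact hb0 ((hbM x hx y hy hxy.2).1 hxy.1)
  rcases hM.2 with h | h
  · exact key κ fun x hx y hy hxy => (h _ ⟨hxy, y, hy, Sym2.mem_mk_right x y⟩).trans (hκ x hx y hy hxy)
  · refine key (¬ κ) fun x hx y hy hxy => (h _ ⟨hxy, y, hy, Sym2.mem_mk_right x y⟩).trans ?_
    rw [hκ x hx y hy hxy]

end Lemmas

end Apex

end Antithetic

end Summit.CriticalPhenomena.PercolationContinuityZ3.Theorems
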